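import Summits.QuantumAdvantage.QuantumAdvantage.Theorems.SosSandwichPseudoBoundedAABooleanCorner
import Literature.Computability.QuantumComplexity.DFKOInfluenceBoundProofs
import HarnessLib

/-!
# Crux `PseudoBoundedAA` (stmt-QuantumAdvantage-15237, route SosSandwich) — the SIGNED Boolean corner and the
homogeneous Boolean case of the two-certificate contraction consequence

Support file (`--supports stmt-QuantumAdvantage-15237`, helper; nothing here proves the crux or the summit).

`SosSandwichPseudoBoundedAABooleanCorner.lean` proves the AA influence law for `{0,1}`-VALUED members of the
sandwich class `K_T` (`Var[p] ≤ 8T³·maxᵢ Infᵢ[p]`, OSSS + Midrijanis).  The calibration file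
`SosSandwichPseudoBoundedTopPairingContractionTwoCert.lean` (explicit-unit hand g2) showed that the TWO-CERTIFICATE
uniform contraction bound (H2) with constant `K(T)` forces, for every `±1`-VALUED `g` of degree `≤ T`,
`∃ k, (W^{=T}[g])² ≤ K(T) · Σ_{|S| = T, S ∋ k} ĝ(S)²`, and asked (census item (3) of CONTRACTION-CALIBRATION-15237)
whether HOMOGENEOUS `±1`-valued families (all Fourier weight on level `T`) can falsify it.  This file answers that
sub-question in the negative, unconditionally:

* `evalBool_eq_one_or_eq_neg_one` — `g(x)² = 1` on the cube means `g(x) ∈ {1, −1}`;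
* `pseudoBounded_half_one_add` — for a `±1`-valued `g` of total degree `≤ T`, the polynomial `(1 + g)/2` is a
  `{0,1}`-valued member of `K_T` with the ONE-TERM certificates `(1+g)/2 = ((1+g)/2)²`, `(1−g)/2 = ((1−g)/2)²`;
* `boolVariance_half_one_add`, `influence_half_one_add` — `Var[(1+g)/2] = Var[g]/4`, `Infᵢ[(1+g)/2] = Infᵢ[g]/4`;
* **`exists_influence_ge_of_sq_eq_one`** — AA for `±1`-valued polynomials of degree `≤ T` in the tree's vocabulary:
  `Var[g] ≤ 8T³ · Infᵢ[g]` for some `i` (the signed form of `BooleanCorner.exists_influence_ge_of_boolean`);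
* **`exists_topRow_ge_of_boolean_homogeneous`** — if moreover every non-zero Fourier coefficient of `g` sits on
  level `T` (`T ≥ 1`) and `W^{=T}[g] > 0`, then `∃ k, (W^{=T}[g])² ≤ 32T³ · Σ_{|S| = T, S ∋ k} ĝ(S)²`: the conclusion
  of `TopPairing.exists_topRow_ge_of_twoCertContraction_boolean` holds WITHOUT the hypothesis (H2), with
  `K(T) = 32T³`; `exists_topRow_ge_of_boolean_homogeneous_of_le` packages it for any `K` with `32T³ ≤ K T`.

Reading for the census: a Boolean falsifier of a polynomial two-certificate bound must be NON-homogeneous (top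
weight `T^{-O(1)} ≤ W^{=T}[g] < 1` spread over `T^{ω(1)}` variables); on homogeneous Boolean data the ratio
`max_k rowW_k / (W^{=T})²` is at least `1/(32T³)` (and at most `1/T`, composed four-variable quadratic — not
formalised here), so such data can at best separate `K(T) = O(T)` from `K(T) = O(T³)`.

All proved; axioms `propext`, `Classical.choice`, `Quot.sound`.  Sources: R. O'Donnell, M. Saks, O. Schramm,
R. Servedio, FOCS 2005 (arXiv:cs/0508071) Thm 1.1; G. Midrijanis, arXiv:quant-ph/0403168 Thm 4; S. Aaronson,
A. Ambainis, Theory Comput. 10 (2014) (arXiv:0911.0996) Conj. 6 and the remark on Boolean functions; R. O'Donnell,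
Analysis of Boolean Functions (CUP 2014) §1.4, §2.2; J. Kaniewski, T. Lee, R. de Wolf, ICALP 2015 (arXiv:1411.7280)
Def. 7.
-/

set_option linter.dupNamespace false

noncomputable section

namespace Summit.QuantumAdvantage.QuantumAdvantage.Theorems.SosSandwich

open Finset MvPolynomial
open Literature.Computability.Complexity Literature.Computability.QuantumComplexity
open Literature.Computability.Complexity.LowDegree

namespace BooleanSigned

variable {N : ℕ}

/-! ### `±1`-valued polynomials and the half-shift `(1 + g)/2` -/

/-- On the cube, `g(x)² = 1` means `g(x) = 1` or `g(x) = -1`. [folklore] -/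
theorem evalBool_eq_one_or_eq_neg_one {g : MvPolynomial (Fin N) ℝ} (hbool : ∀ x, evalBool g x ^ 2 = 1)
    (x : Fin N → Bool) : evalBool g x = 1 ∨ evalBool g x = -1 := by
  have h := hbool x
  have h' : (evalBool g x - 1) * (evalBool g x + 1) = 0 := by nlinarith [h]
  rcases mul_eq_zero.mp h' with h1 | h1
  · left; linarith
  · right; linarith

/-- Evaluation of the half-shift: `((1 + g)/2)(x) = (1 + g(x))/2`. [folklore] -/
theorem evalBool_half_one_add (g : MvPolynomial (Fin N) ℝ) (x : Fin N → Bool) :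
    evalBool (C (1 / 2 : ℝ) * (1 + g)) x = (1 + evalBool g x) / 2 := by
  unfold evalBool
  rw [map_mul, eval_C, map_add, map_one]
  ring

/-- Evaluation of the complementary half-shift: `((1 - g)/2)(x) = (1 - g(x))/2`. [folklore] -/
theorem evalBool_half_one_sub (g : MvPolynomial (Fin N) ℝ) (x : Fin N → Bool) :
    evalBool (C (1 / 2 : ℝ) * (1 - g)) x = (1 - evalBool g x) / 2 := by
  unfold evalBool
  rw [map_mul, eval_C, map_sub, map_one]
  ring

/-- The half-shift does not raise the total degree. [folklore] -/
theorem totalDegree_half_one_add_le (g : MvPolynomial (Fin N) ℝ) :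
    (C (1 / 2 : ℝ) * (1 + g)).totalDegree ≤ g.totalDegree := by
  calc (C (1 / 2 : ℝ) * (1 + g)).totalDegree ≤ (C (1 / 2 : ℝ)).totalDegree + (1 + g).totalDegree :=
        totalDegree_mul _ _
    _ ≤ 0 + max (1 : MvPolynomial (Fin N) ℝ).totalDegree g.totalDegree := by
        rw [totalDegree_C]; exact Nat.add_le_add_left (totalDegree_add _ _) 0
    _ = g.totalDegree := by rw [totalDegree_one, zero_add, Nat.zero_max]

/-- The complementary half-shift does not raise the total degree. [folklore] -/
theorem totalDegree_half_one_sub_le (g : MvPolynomial (Fin N) ℝ) :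
    (C (1 / 2 : ℝ) * (1 - g)).totalDegree ≤ g.totalDegree := by
  calc (C (1 / 2 : ℝ) * (1 - g)).totalDegree ≤ (C (1 / 2 : ℝ)).totalDegree + (1 - g).totalDegree :=
        totalDegree_mul _ _
    _ ≤ 0 + max (1 : MvPolynomial (Fin N) ℝ).totalDegree g.totalDegree := by
        rw [totalDegree_C]; exact Nat.add_le_add_left (totalDegree_sub _ _) 0
    _ = g.totalDegree := by rw [totalDegree_one, zero_add, Nat.zero_max]

/-- **A `±1`-valued polynomial of degree `≤ T` gives a `{0,1}`-valued member of `K_T`.**  For `g` with `g(x)² = 1`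
on the cube and `deg g ≤ T`, the half-shift `(1 + g)/2` is pseudo-bounded of order `T`, with the one-term SOS
certificates `(1+g)/2 = ((1+g)/2)²` and `1 − (1+g)/2 = ((1−g)/2)²` on the cube.
[cite: KaniewskiLeeDewolf2015, Def. 7] -/
theorem pseudoBounded_half_one_add {T : ℕ} {g : MvPolynomial (Fin N) ℝ} (hg : g.totalDegree ≤ T)
    (hbool : ∀ x, evalBool g x ^ 2 = 1) : PseudoBounded T (C (1 / 2 : ℝ) * (1 + g)) := by
  refine ⟨1, fun _ => C (1 / 2 : ℝ) * (1 + g), fun _ => C (1 / 2 : ℝ) * (1 - g),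
    fun _ => ⟨(totalDegree_half_one_add_le g).trans hg, (totalDegree_half_one_sub_le g).trans hg⟩,
    fun x => ⟨?_, ?_⟩⟩
  · rw [Fin.sum_univ_one]
    change evalBool (C (1 / 2 : ℝ) * (1 + g)) x = evalBool (C (1 / 2 : ℝ) * (1 + g)) x ^ 2
    rw [evalBool_half_one_add]
    have h := hbool x
    nlinarith [h]
  · rw [Fin.sum_univ_one]
    change 1 - evalBool (C (1 / 2 : ℝ) * (1 + g)) x = evalBool (C (1 / 2 : ℝ) * (1 - g)) x ^ 2
    rw [evalBool_half_one_add, evalBool_half_one_sub]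
    have h := hbool x
    nlinarith [h]

/-- The half-shift of a `±1`-valued polynomial is `{0,1}`-valued on the cube. [folklore] -/
theorem evalBool_half_one_add_boolean {g : MvPolynomial (Fin N) ℝ} (hbool : ∀ x, evalBool g x ^ 2 = 1)
    (x : Fin N → Bool) :
    evalBool (C (1 / 2 : ℝ) * (1 + g)) x = 0 ∨ evalBool (C (1 / 2 : ℝ) * (1 + g)) x = 1 := by
  rw [evalBool_half_one_add]
  rcases evalBool_eq_one_or_eq_neg_one hbool x with h | h
  · right; rw [h]; norm_num
  · left; rw [h]; norm_num

/-! ### Variance and influences scale by `1/4` under the half-shift -/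

/-- The mean of the half-shift: `E[(1+g)/2] = (1 + E g)/2`. [folklore] -/
theorem boolAvg_half_one_add (g : MvPolynomial (Fin N) ℝ) :
    boolAvg (evalBool (C (1 / 2 : ℝ) * (1 + g))) = (1 + boolAvg (evalBool g)) / 2 := by
  unfold boolAvg
  simp_rw [evalBool_half_one_add]
  have h2 : (2 : ℝ) ^ N ≠ 0 := by positivity
  have hsum : ∑ x : Fin N → Bool, (1 + evalBool g x) / 2 = ((2 : ℝ) ^ N + ∑ x, evalBool g x) / 2 := by
    rw [← Finset.sum_div, Finset.sum_add_distrib, Finset.sum_const, Finset.card_univ,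
      BooleanCorner.card_cube_nat, nsmul_eq_mul, mul_one]
    push_cast
    ring
  rw [hsum]
  field_simp

/-- `Var[(1+g)/2] = Var[g]/4`. [folklore] -/
theorem boolVariance_half_one_add (g : MvPolynomial (Fin N) ℝ) :
    boolVariance (C (1 / 2 : ℝ) * (1 + g)) = boolVariance g / 4 := by
  unfold boolVariance
  rw [boolAvg_half_one_add]
  unfold boolAvg
  simp_rw [evalBool_half_one_add]
  have key : ∀ a b : ℝ, ((1 + a) / 2 - (1 + b) / 2) ^ 2 = (a - b) ^ 2 / 4 := by intro a b; ring
  simp only [key]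
  rw [← Finset.sum_div, div_div, div_div, mul_comm]

/-- `Infᵢ[(1+g)/2] = Infᵢ[g]/4`. [folklore] -/
theorem influence_half_one_add (i : Fin N) (g : MvPolynomial (Fin N) ℝ) :
    influence i (C (1 / 2 : ℝ) * (1 + g)) = influence i g / 4 := by
  unfold influence boolAvg
  simp_rw [evalBool_half_one_add]
  have key : ∀ a b : ℝ, ((1 + a) / 2 - (1 + b) / 2) ^ 2 = (a - b) ^ 2 / 4 := by intro a b; ring
  simp only [key]
  rw [← Finset.sum_div, div_div, div_div, mul_comm]

/-! ### AA for `±1`-valued polynomials of degree `≤ T` -/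

/-- **The signed Boolean corner.**  A `±1`-valued polynomial `g` on the cube of total degree `≤ T` with
`Var[g] > 0` has a variable with `Var[g] ≤ 8T³ · Infᵢ[g]` — OSSS `Var ≤ D·maxInf/4` for the total Boolean function
`g`, with `D ≤ bs·deg ≤ 32T³` (Midrijanis, Nisan–Szegedy), transported through the half-shift `(1+g)/2 ∈ K_T`.
[cite: OdonnellEtAl2005, Thm 1.1] [cite: Midrijanis2004, Thm 4]
[cite: AaronsonAmbainis2014, §1 (Conj. 6 and the remark on Boolean functions)] -/
theorem exists_influence_ge_of_sq_eq_one {T : ℕ} {g : MvPolynomial (Fin N) ℝ} (hg : g.totalDegree ≤ T)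
    (hbool : ∀ x, evalBool g x ^ 2 = 1) (hv : 0 < boolVariance g) :
    ∃ i : Fin N, boolVariance g ≤ 8 * (T : ℝ) ^ 3 * influence i g := by
  have hpb := pseudoBounded_half_one_add hg hbool
  have hv' : 0 < boolVariance (C (1 / 2 : ℝ) * (1 + g)) := by
    rw [boolVariance_half_one_add]; positivity
  obtain ⟨i, hi⟩ := BooleanCorner.exists_influence_ge_of_boolean hpb (evalBool_half_one_add_boolean hbool) hv'
  refine ⟨i, ?_⟩
  rw [boolVariance_half_one_add, influence_half_one_add] at hi
  linarith

/-- Route-item vocabulary (inline cube averages, as in `SosSandwich.PseudoBoundedAA`): for every `N`, `T`, every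
`±1`-valued `g` of total degree `≤ T` and every `0 < ε ≤ Var[g]`, some variable has `ε/(8T³) ≤ Inf_i[g]`.
[cite: OdonnellEtAl2005, Thm 1.1] [cite: Midrijanis2004, Thm 4] -/
theorem signedBooleanCorner (N T : ℕ) (g : MvPolynomial (Fin N) ℝ) (ε : ℝ) :
    let ev : MvPolynomial (Fin N) ℝ → (Fin N → Bool) → ℝ :=
      fun f x => MvPolynomial.eval (fun k => if x k then (1 : ℝ) else 0) f
    let avg : ((Fin N → Bool) → ℝ) → ℝ := fun g => (∑ x : Fin N → Bool, g x) / (2 : ℝ) ^ N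
    g.totalDegree ≤ T → (∀ x : Fin N → Bool, ev g x ^ 2 = 1) →
    0 < ε → ε ≤ (avg fun x => (ev g x - avg (ev g)) ^ 2) →
    ∃ i : Fin N, ε / (8 * (T : ℝ) ^ 3) ≤ (avg fun x => (ev g x - ev g (Function.update x i (!x i))) ^ 2) := by
  intro ev avg hg hbool hε hεV
  have hεV' : ε ≤ boolVariance g := hεV
  have hv : 0 < boolVariance g := lt_of_lt_of_le hε hεV'
  have hT0 : T ≠ 0 := by
    rintro rfl
    -- degree `0`: `g` is constant on the cube, so its variance vanishes
    have hg0 : g.totalDegree = 0 := Nat.le_zero.mp hg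
    have hconst : ∀ x : Fin N → Bool, evalBool g x = evalBool g (fun _ => false) := by
      intro x
      rw [totalDegree_eq_zero_iff_eq_C.mp hg0]
      unfold evalBool
      rw [eval_C, eval_C]
    have hV0 : boolVariance g = 0 := by
      have hμ : boolAvg (evalBool g) = evalBool g (fun _ => false) := by
        unfold boolAvg
        rw [Finset.sum_congr rfl fun x _ => hconst x, Finset.sum_const, Finset.card_univ,
          BooleanCorner.card_cube_nat, nsmul_eq_mul]
        push_cast
        field_simp
      unfold boolVariance
      rw [hμ]
      unfold boolAvg
      rw [Finset.sum_eq_zero fun x _ => by rw [hconst x, sub_self, zero_pow two_ne_zero], zero_div]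
    exact absurd hV0 hv.ne'
  obtain ⟨i, hi⟩ := exists_influence_ge_of_sq_eq_one hg hbool hv
  refine ⟨i, ?_⟩
  change ε / (8 * (T : ℝ) ^ 3) ≤ influence i g
  have hT3 : (0 : ℝ) < 8 * (T : ℝ) ^ 3 := by
    have : (0 : ℝ) < T := by exact_mod_cast Nat.pos_of_ne_zero hT0
    positivity
  rw [div_le_iff₀ hT3]
  linarith

/-! ### The homogeneous Boolean case of the two-certificate contraction consequence, unconditionally -/

/-- Parseval for a `±1`-valued polynomial: `Σ_S ĝ(S)² = 1`. [cite: ODonnell2014, §1.4] -/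
theorem sum_sq_fourier_eq_one_of_sq_eq_one {g : MvPolynomial (Fin N) ℝ} (hbool : ∀ x, evalBool g x ^ 2 = 1) :
    ∑ S : Finset (Fin N), cubeFourierCoeff (evalBool g) S ^ 2 = 1 := by
  rw [sum_cubeFourierCoeff_sq]
  rw [Finset.sum_congr rfl fun x _ => hbool x, Finset.sum_const, Finset.card_univ,
    BooleanCorner.card_cube_nat, nsmul_eq_mul, mul_one]
  push_cast
  exact div_self (by positivity)

/-- **Homogeneous `±1`-valued data satisfy the two-certificate contraction consequence with `K(T) = 32T³`,
unconditionally.**  Let `T ≥ 1` and let `g` be `±1`-valued on the cube, of total degree `≤ T`, with every non-zero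
Fourier coefficient on level exactly `T` and `W^{=T}[g] > 0`.  Then
`∃ k, (W^{=T}[g])² ≤ 32T³ · Σ_{|S| = T, S ∋ k} ĝ(S)²` — the conclusion of
`TopPairing.exists_topRow_ge_of_twoCertContraction_boolean` without its hypothesis (H2).  Proof: `W^{=T} = Var[g] ≤ 1`
(Parseval, `Var = W^{≥1}` by `boolVariance_eq_tailWeight_one`), `Inf_k[g] = 4·Σ_{|S|=T, S∋k} ĝ(S)²` (homogeneity), and the
signed Boolean corner.
[cite: OdonnellEtAl2005, Thm 1.1] [cite: Midrijanis2004, Thm 4] [cite: ODonnell2014, §2.2] -/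
theorem exists_topRow_ge_of_boolean_homogeneous {T : ℕ} (hT : 1 ≤ T) (g : MvPolynomial (Fin N) ℝ)
    (hg : g.totalDegree ≤ T) (hbool : ∀ x, evalBool g x ^ 2 = 1)
    (hhom : ∀ S : Finset (Fin N), cubeFourierCoeff (evalBool g) S ≠ 0 → S.card = T)
    (hW : 0 < ∑ S ∈ Finset.univ.filter (fun S : Finset (Fin N) => S.card = T), cubeFourierCoeff (evalBool g) S ^ 2) :
    ∃ k : Fin N, (∑ S ∈ Finset.univ.filter (fun S : Finset (Fin N) => S.card = T),
        cubeFourierCoeff (evalBool g) S ^ 2) ^ 2 ≤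
      32 * (T : ℝ) ^ 3 * ∑ S ∈ Finset.univ.filter (fun S : Finset (Fin N) => S.card = T ∧ k ∈ S),
        cubeFourierCoeff (evalBool g) S ^ 2 := by
  classical
  set W := ∑ S ∈ Finset.univ.filter (fun S : Finset (Fin N) => S.card = T),
    cubeFourierCoeff (evalBool g) S ^ 2 with hWdef
  -- coefficients off level `T` vanish
  have hzero : ∀ S : Finset (Fin N), S.card ≠ T → cubeFourierCoeff (evalBool g) S ^ 2 = 0 := by
    intro S hS
    have : cubeFourierCoeff (evalBool g) S = 0 := by
      by_contra h
      exact hS (hhom S h)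
    rw [this]; ring
  -- `W = Var[g]` (`Var = W^{≥ 1}`, and the weight off level `T ≥ 1` vanishes)
  have hVar : boolVariance g = W := by
    rw [boolVariance_eq_tailWeight_one]
    unfold tailWeight
    rw [hWdef, Finset.sum_filter, Finset.sum_filter]
    refine Finset.sum_congr rfl fun S _ => ?_
    by_cases hS : S.card = T
    · have hT0 : T ≠ 0 := by omega
      simp [hS, hT0]
    · have hz := hzero S hS
      by_cases h1 : 1 ≤ S.card <;> simp [hS, h1, hz]
  -- `W ≤ 1`
  have hW1 : W ≤ 1 := by
    rw [← sum_sq_fourier_eq_one_of_sq_eq_one hbool, hWdef]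
    exact Finset.sum_le_sum_of_subset_of_nonneg (Finset.filter_subset _ _) fun S _ _ => sq_nonneg _
  -- the signed Boolean corner
  have hv : 0 < boolVariance g := by rw [hVar]; exact hW
  obtain ⟨k, hk⟩ := exists_influence_ge_of_sq_eq_one hg hbool hv
  refine ⟨k, ?_⟩
  -- `Inf_k[g] = 4 · (top row of k)`
  have hInf : influence k g = 4 * ∑ S ∈ Finset.univ.filter (fun S : Finset (Fin N) => S.card = T ∧ k ∈ S),
      cubeFourierCoeff (evalBool g) S ^ 2 := by
    rw [influence_eq_sum_sq_fourier]
    congr 1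
    rw [Finset.sum_filter, Finset.sum_filter]
    refine Finset.sum_congr rfl fun S _ => ?_
    by_cases hS : S.card = T
    · simp [hS]
    · have hz := hzero S hS
      by_cases hk : k ∈ S <;> simp [hS, hk, hz]
  rw [hVar] at hk
  rw [hInf] at hk
  have hW0 : 0 ≤ W := hW.le
  calc W ^ 2 = W * W := sq W
    _ ≤ 1 * W := mul_le_mul_of_nonneg_right hW1 hW0
    _ = W := one_mul W
    _ ≤ 8 * (T : ℝ) ^ 3 * (4 * ∑ S ∈ Finset.univ.filter (fun S : Finset (Fin N) => S.card = T ∧ k ∈ S),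
        cubeFourierCoeff (evalBool g) S ^ 2) := hk
    _ = 32 * (T : ℝ) ^ 3 * ∑ S ∈ Finset.univ.filter (fun S : Finset (Fin N) => S.card = T ∧ k ∈ S),
        cubeFourierCoeff (evalBool g) S ^ 2 := by ring

/-- Packaging for any candidate constant of the two-certificate line: if `32T³ ≤ K T` then the conclusion of
`TopPairing.exists_topRow_ge_of_twoCertContraction_boolean` with constant `K` holds on every homogeneous `±1`-valued
`g` of degree `≤ T` — no hypothesis (H2) needed; so no such family can falsify a bound `K(T) ≥ 32T³`.
[cite: OdonnellEtAl2005, Thm 1.1] [cite: Midrijanis2004, Thm 4] -/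
theorem exists_topRow_ge_of_boolean_homogeneous_of_le (K : ℕ → ℝ) {T : ℕ} (hT : 1 ≤ T)
    (hK : 32 * (T : ℝ) ^ 3 ≤ K T) (g : MvPolynomial (Fin N) ℝ)
    (hg : g.totalDegree ≤ T) (hbool : ∀ x, evalBool g x ^ 2 = 1)
    (hhom : ∀ S : Finset (Fin N), cubeFourierCoeff (evalBool g) S ≠ 0 → S.card = T)
    (hW : 0 < ∑ S ∈ Finset.univ.filter (fun S : Finset (Fin N) => S.card = T), cubeFourierCoeff (evalBool g) S ^ 2) :
    ∃ k : Fin N, (∑ S ∈ Finset.univ.filter (fun S : Finset (Fin N) => S.card = T),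
        cubeFourierCoeff (evalBool g) S ^ 2) ^ 2 ≤
      K T * ∑ S ∈ Finset.univ.filter (fun S : Finset (Fin N) => S.card = T ∧ k ∈ S),
        cubeFourierCoeff (evalBool g) S ^ 2 := by
  obtain ⟨k, hk⟩ := exists_topRow_ge_of_boolean_homogeneous hT g hg hbool hhom hW
  refine ⟨k, hk.trans ?_⟩
  exact mul_le_mul_of_nonneg_right hK (Finset.sum_nonneg fun S _ => sq_nonneg _)

/-- Influence form: a homogeneous `±1`-valued `g` of degree `≤ T` (`T ≥ 1`, `W^{=T}[g] > 0`) has a variable with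
`(W^{=T}[g])² ≤ 8T³ · Inf_k[g]`, i.e. `maxₖ Infₖ[g] ≥ Var[g]²/(8T³)` with `Var[g] = W^{=T}[g]`.
[cite: OdonnellEtAl2005, Thm 1.1] [cite: Midrijanis2004, Thm 4] [cite: ODonnell2014, §2.2] -/
theorem exists_influence_ge_topWeight_sq_of_boolean_homogeneous {T : ℕ} (hT : 1 ≤ T)
    (g : MvPolynomial (Fin N) ℝ) (hg : g.totalDegree ≤ T) (hbool : ∀ x, evalBool g x ^ 2 = 1)
    (hhom : ∀ S : Finset (Fin N), cubeFourierCoeff (evalBool g) S ≠ 0 → S.card = T)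
    (hW : 0 < ∑ S ∈ Finset.univ.filter (fun S : Finset (Fin N) => S.card = T), cubeFourierCoeff (evalBool g) S ^ 2) :
    ∃ k : Fin N, (∑ S ∈ Finset.univ.filter (fun S : Finset (Fin N) => S.card = T),
        cubeFourierCoeff (evalBool g) S ^ 2) ^ 2 ≤ 8 * (T : ℝ) ^ 3 * influence k g := by
  classical
  obtain ⟨k, hk⟩ := exists_topRow_ge_of_boolean_homogeneous hT g hg hbool hhom hW
  refine ⟨k, hk.trans ?_⟩
  rw [influence_eq_sum_sq_fourier]
  have hsub : ∑ S ∈ Finset.univ.filter (fun S : Finset (Fin N) => S.card = T ∧ k ∈ S),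
      cubeFourierCoeff (evalBool g) S ^ 2 ≤
      ∑ S ∈ Finset.univ.filter (fun S : Finset (Fin N) => k ∈ S), cubeFourierCoeff (evalBool g) S ^ 2 :=
    Finset.sum_le_sum_of_subset_of_nonneg
      (fun S hS => by
        rw [Finset.mem_filter] at hS ⊢
        exact ⟨hS.1, hS.2.2⟩)
      fun S _ _ => sq_nonneg _
  have hT3 : (0 : ℝ) ≤ 8 * (T : ℝ) ^ 3 := by positivity
  calc 32 * (T : ℝ) ^ 3 * ∑ S ∈ Finset.univ.filter (fun S : Finset (Fin N) => S.card = T ∧ k ∈ S),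
        cubeFourierCoeff (evalBool g) S ^ 2
      = 8 * (T : ℝ) ^ 3 * (4 * ∑ S ∈ Finset.univ.filter (fun S : Finset (Fin N) => S.card = T ∧ k ∈ S),
        cubeFourierCoeff (evalBool g) S ^ 2) := by ring
    _ ≤ 8 * (T : ℝ) ^ 3 * (4 * ∑ S ∈ Finset.univ.filter (fun S : Finset (Fin N) => k ∈ S),
        cubeFourierCoeff (evalBool g) S ^ 2) :=
        mul_le_mul_of_nonneg_left (mul_le_mul_of_nonneg_left hsub (by norm_num)) hT3

end BooleanSigned

end Summit.QuantumAdvantage.QuantumAdvantage.Theorems.SosSandwich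

end
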